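import Summits.NavierStokesRegularity.NavierStokesRegularity.Theorems.EulerZoomLiouvillePowerGaugeEulerLiouvilleSpiralProfileEnergyEquality
import Summits.NavierStokesRegularity.NavierStokesRegularity.Theorems.EulerZoomLiouvillePowerGaugeEulerLiouvilleSpiralProfileGradient

/-!
# Spiral (O(3)-twisted) self-similar profiles: the RADIAL local energy equality (R3a's clause)
# (crux `EulerZoomLiouville.PowerGaugeEulerLiouville` = stmt-NavierStokesRegularity-19832; line `relative_equilibria`, brick R3a-P7, file 4/4)

Route `EulerZoomLiouville` (NavierStokesRegularity); width seat ns-ezl-w3 g9, LEAD 19832 ns-typeII-p2 g17 KEY «R3a-P7».  `--supports` stmt-19832.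
For a SKEW generator `S` (`⟪Sx, y⟫ = −⟪x, Sy⟫`) the trace vanishes (`Spiral.trace_eq_zero_of_skew`), `⟪SV, V⟫ = 0`
(`Spiral.inner_self_of_skew`, ns-ezl-w1 g10) and `⟪Sy, ∇σ(y)⟫ = 0` for every RADIAL-GRADIENT test `σ` (`∇σ(z) = m(z)·z`); hence the two
S-terms of `Spiral.profile_local_energy_equality` vanish POINTWISE and the untwisted local energy equality
`(2 − 5γ)∫σ|V|² = ∫(|V|² + 2P)⟪V,∇σ⟫ + γ∫|V|²⟪y,∇σ⟫` holds VERBATIM for radial-gradient tests — the «radial LEE» clause of R3a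
`Sig.stub_spiralLocData` (Lines/relative_equilibria.lean) in the shape consumed by `Spiral.locData_unify` (`hEE`, ns-ezl-w1 g10).  For
non-radial tests the torque term `∫|V|²⟪Sy,∇σ⟫` does not vanish (`S ≠ 0`): the documented dead end of the line card (V47 P1).
WHAT THIS IS NOT: not NS, not E — a tool for the spiral stratum of the MODEL-lattice crux class; 19832 OPEN. [folklore]
-/

noncomputable section

set_option linter.dupNamespace false

open MeasureTheory Set Filter Topology Metric Function TopologicalSpace
open scoped ENNReal NNReal RealInnerProductSpace

namespace Summit.NavierStokesRegularity.NavierStokesRegularity.Theorems.PowerGaugeEulerLiouville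

open Literature.Analysis Literature.Analysis.FunctionSpaces Literature.Analysis.FluidPDE

namespace Spiral

/-- A skew endomorphism of `ℝ³` is trace-free (`tr S = Σᵢ ⟪eᵢ, S eᵢ⟫ = 0`). [folklore] -/
theorem trace_eq_zero_of_skew {S : EuclideanSpace ℝ (Fin 3) →L[ℝ] EuclideanSpace ℝ (Fin 3)}
    (hS : ∀ x y : EuclideanSpace ℝ (Fin 3), ⟪S x, y⟫ = -⟪x, S y⟫) :
    LinearMap.trace ℝ (EuclideanSpace ℝ (Fin 3)) (S : EuclideanSpace ℝ (Fin 3) →ₗ[ℝ] EuclideanSpace ℝ (Fin 3)) = 0 := by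
  rw [LinearMap.trace_eq_sum_inner _ (EuclideanSpace.basisFun (Fin 3) ℝ)]
  refine Finset.sum_eq_zero fun i _ => ?_
  have h := inner_self_of_skew hS ((EuclideanSpace.basisFun (Fin 3) ℝ) i)
  rw [real_inner_comm] at h
  exact h

/-- ★ **THE RADIAL LOCAL ENERGY EQUALITY of a weak SPIRAL self-similar Euler profile** (R3a's radial-LEE clause): for skew `S`, the
spiral weak profile equation, `V ∈ L⁶_loc` with weak gradient in `L²_loc`, `P ∈ L^{3/2}_loc`, `V` weakly divergence free, and a
RADIAL-GRADIENT test function `σ` (`∇σ(z) = m(z)·z`), the untwisted local energy equality holds verbatim: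
`(2 − 5γ) ∫ σ|V|² = ∫ (|V|² + 2P)⟪V, ∇σ⟫ + γ ∫ |V|² ⟪y, ∇σ⟫` (both S-terms of `Spiral.profile_local_energy_equality` vanish
pointwise: `⟪Sz, m·z⟫ = 0`, `⟪SV, V⟫ = 0`). [folklore; cf. ChaeShvydkoy2013 §2.2 eq. (2.9)] -/
theorem profile_local_energy_equality_radial {γ : ℝ}
    {V : EuclideanSpace ℝ (Fin 3) → EuclideanSpace ℝ (Fin 3)} {P : EuclideanSpace ℝ (Fin 3) → ℝ}
    {G : EuclideanSpace ℝ (Fin 3) → EuclideanSpace ℝ (Fin 3) →L[ℝ] EuclideanSpace ℝ (Fin 3)}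
    (hVG : HasWeakFDerivOn (⊤ : Opens (EuclideanSpace ℝ (Fin 3))) volume V G)
    (hV6 : ∀ r : ℝ, MemLp V 6 (volume.restrict (ball (0 : EuclideanSpace ℝ (Fin 3)) r)))
    (hG2 : ∀ r : ℝ, MemLp G 2 (volume.restrict (ball (0 : EuclideanSpace ℝ (Fin 3)) r)))
    (hPm : AEStronglyMeasurable P volume)
    (hP : ∀ r : ℝ, MemLp P (3 / 2 : ℝ≥0∞) (volume.restrict (ball (0 : EuclideanSpace ℝ (Fin 3)) r)))
    (hdiv : IsWeaklyDivFree V) {S : EuclideanSpace ℝ (Fin 3) →L[ℝ] EuclideanSpace ℝ (Fin 3)}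
    (hS : ∀ x y : EuclideanSpace ℝ (Fin 3), ⟪S x, y⟫ = -⟪x, S y⟫)
    (heq : ∀ ψ : EuclideanSpace ℝ (Fin 3) → EuclideanSpace ℝ (Fin 3),
      IsTestFunctionOn (⊤ : Opens (EuclideanSpace ℝ (Fin 3))) ψ →
        ∫ x, (⟪V x, fderiv ℝ ψ x (V x)⟫ + P x * VectorCalculus.divergence ψ x +
          γ * ⟪V x, fderiv ℝ ψ x x⟫ + ⟪V x, fderiv ℝ ψ x (S x)⟫ + (4 * γ - 1) * ⟪V x, ψ x⟫ + ⟪S (V x), ψ x⟫) = 0)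
    {σ : EuclideanSpace ℝ (Fin 3) → ℝ} (hσ : IsTestFunctionOn (⊤ : Opens (EuclideanSpace ℝ (Fin 3))) σ)
    (hrad : ∀ z : EuclideanSpace ℝ (Fin 3), ∃ m : ℝ, gradient σ z = m • z) :
    (2 - 5 * γ) * ∫ x, σ x * ‖V x‖ ^ 2 =
      (∫ x, (‖V x‖ ^ 2 + 2 * P x) * ⟪V x, gradient σ x⟫) +
        γ * ∫ x, ‖V x‖ ^ 2 * ⟪x, gradient σ x⟫ := by
  have h := profile_local_energy_equality hVG hV6 hG2 hPm hP hdiv (trace_eq_zero_of_skew hS) heq hσ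
  have h1 : ∫ x, ‖V x‖ ^ 2 * ⟪S x, gradient σ x⟫ = 0 := by
    have e : (fun x => ‖V x‖ ^ 2 * ⟪S x, gradient σ x⟫) = fun _ => 0 := by
      funext x
      obtain ⟨m, hm⟩ := hrad x
      rw [hm, real_inner_smul_right, inner_self_of_skew hS x, mul_zero, mul_zero]
    rw [e, integral_zero]
  have h2 : ∫ x, σ x * ⟪S (V x), V x⟫ = 0 := by
    have e : (fun x => σ x * ⟪S (V x), V x⟫) = fun _ => 0 := by
      funext x
      rw [inner_self_of_skew hS (V x), mul_zero]
    rw [e, integral_zero]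
  rw [h1, h2] at h
  linarith

end Spiral

end Summit.NavierStokesRegularity.NavierStokesRegularity.Theorems.PowerGaugeEulerLiouville

end
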